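import Literature.NumberTheory.QuadraticFields.GaussRepresentationCount
import Mathlib.NumberTheory.EulerProduct.DirichletLSeries
import Mathlib.NumberTheory.LSeries.Dirichlet
import Mathlib.NumberTheory.LSeries.Convolution
import HarnessLib

/-!
# The Dirichlet series of Gauss's count: `Σ r_n(−d) n^{−s} = Π_p (1 + p^{−s})/(1 − χ(p) p^{−s})`
# (Oesterlé 1988, II §2, display (25); and (23) ⇒ (26))

Topic `NumberTheory/QuadraticFields`, namespace `Literature.NumberTheory.QuadraticFields.Quadratic.BinQF`
(continuing `GaussRepresentationCount.lean`: the Théorème `r_n(−d) = #{b (mod 2n) : b² ≡ −d (mod 4n)}`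
and its Corollaire). Everything here is PROVED (theorems only; no definitions, no named facts).

J. Oesterlé, *Le problème de Gauss sur le nombre de classes*, Enseign. Math. (2) 34 (1988) 43–67,
II §2, p. 56 (read from the page image of p. 56, the PDF's own scan; see the seat deposit
`HOME/goldfeld/lit-scans/oesterle1988-p56.jpg`):

> «(23) ζ_K(s) = Σ_{C ∈ Cl(−d)} ζ(C, s) = ζ(2s) Σ_{n=1}^{∞} r_n(−d) n^{−s} … Notons χ le caractère de
> Dirichlet n ↦ (−d/n). Le théorème de Gauss du § 2, ou plutôt son corollaire, traduit alors
> l'égalité entre séries de Dirichlet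
> (25)  Σ_{n=1}^{∞} r_n(−d) n^{−s} = Π_{p premier} ( (1 + p^{−s}) / (1 − χ(p) p^{−s}) )
> ou encore, compte tenu de (24) [sic; (23)], l'égalité (26) ζ_K(s) = ζ(s) L(χ, s) où L(χ, s) est
> la série de Dirichlet Σ_{n=1}^{∞} χ(n) n^{−s}.»

Here, as in `GaussRepresentationCount.lean`, `−d` is a negative FUNDAMENTAL discriminant (the
discriminant of `K = Q(i√d)`), `r_n(−d)` is typed as Gauss's count
`ρ_d(n) = #{0 ≤ b < 2n : 4n ∣ b² + d}` (`= r_n(−d)` for `d > 4` by the Théorème,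
`two_mul_card_sqrtsMod_eq_sum_card_reps`), and `χ(p)` at a PRIME `p` is the Kronecker symbol
`(−d/p) ∈ {1, 0, −1}`: `0` if `p ∣ d`, `1` if `p ∈ 𝒫_{−d} = kroneckerOnePrimes (−d)` (`p ∤ d` and `−d`
a square mod `4p`), `−1` otherwise [Lenstra–Pomerance 1992 (2.6), the tree's
`LenstraPomeranceKroneckerPrimes.lean`]; only the values `χ(p)` at primes enter (25), so the
theorems take any `χ : ℕ → ℂ` with these values at primes (hypotheses `hχ0`, `hχ1`, `hχ2`).

* `BinaryQuadraticForm.jacobiSym_eq_zero_of_prime_dvd`, `…jacobiSym_eq_one_of_mem_kroneckerOnePrimes`,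
  `…jacobiSym_eq_neg_one_of_not_mem_kroneckerOnePrimes` — at an ODD prime `p` the three Kronecker
  values `0 / 1 / −1` above are Mathlib's Jacobi (= Legendre) symbol `J(D | p)` (so `χ(p) = J(−d | p)`
  for odd `p`; at `p = 2`, `two_mem_kroneckerOnePrimes_iff`: `χ(2) = 1 ⟺ −d ≡ 1 (mod 8)`);
* `card_sqrtsMod_one`, `card_sqrtsMod_mul` — `ρ_d` is multiplicative («En décomposant Z/4nZ en ses
  composantes primaires», CRT, from `card_qroots_mul`);
* `card_sqrtsMod_prime_pow_of_mem` (`= 2`, `p ∈ 𝒫_{−d}`), `card_sqrtsMod_prime_of_dvd` (`= 1`,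
  `p ∣ d`), `card_sqrtsMod_prime_pow_of_dvd` (`= 0`, `p ∣ d`, exponent `≥ 2`),
  `card_sqrtsMod_prime_pow_of_not_mem` (`= 0`, `p` inert) — the local content of the Corollaire;
* `hasSum_card_sqrtsMod_prime_pow_mul` — the local factor
  `Σ_{e ≥ 0} ρ_d(p^e) x^e = (1 + x)/(1 − χ(p) x)` for `‖x‖ < 1`;
* `card_sqrtsMod_le_card_divisors`, `LSeriesSummable_card_sqrtsMod` — `ρ_d(n) ≤ d(n)`, so the
  Dirichlet series converges absolutely for `Re s > 1`;
* **`LSeries_card_sqrtsMod_eulerProduct_hasProd` / `LSeries_card_sqrtsMod_eq_eulerProduct`** — the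
  display **(25)** as printed, `Σ_{n ≥ 1} ρ_d(n) n^{−s} = Π_p (1 + p^{−s})/(1 − χ(p) p^{−s})`
  (`Re s > 1`), by the Euler product for multiplicative functions (`EulerProduct.eulerProduct_hasProd`);
* `LSeries_sum_card_reps_eq_eulerProduct` — the same with `r_n(−d) = ½ Σ_{q_i} #reps(q_i, n)`
  (`d > 4`);
* **`riemannZeta_mul_LSeries_card_sqrtsMod`** — «ou encore … (26)»: for a Dirichlet character `κ`
  whose values at primes are `χ(p)`, `ζ(2s) · Σ ρ_d(n) n^{−s} = ζ(s) L(κ, s)` (`Re s > 1`), from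
  (25) and the Euler products of `ζ` and `L(κ, ·)` — together with the tree's (23)
  (`dedekindZeta_eq_half_sum_epsteinZeta`, field side) this is Oesterlé's route to (26).

## References

* [Oesterle1988Gauss] J. Oesterlé, Enseign. Math. (2) 34 (1988), II §2, (23)–(26) p. 56.
* [LenstraPomerance1992] H. W. Lenstra Jr., C. Pomerance, J. Amer. Math. Soc. 5 (1992), §2 (2.6)
  (the Kronecker symbol at a prime).
-/

namespace Literature.NumberTheory.QuadraticFields.BinaryQuadraticForm

/-! ### The Kronecker symbol `(D/p)` at an odd prime is the Legendre–Jacobi symbol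

Oesterlé's `χ(p) = (−d/p)`; Lenstra–Pomerance (2.6): `(D/p) = 0` if `p ∣ D`, `1` if `p ∤ D` and `D`
is a square modulo `4p` (`p ∈ 𝒫_D = kroneckerOnePrimes D`), `−1` otherwise. For an odd prime `p`
these are the values of Mathlib's Jacobi (= Legendre) symbol `J(D | p)`; at `p = 2` the value is
given by `two_mem_kroneckerOnePrimes_iff` (`(D/2) = 1 ⟺ D ≡ 1 (mod 8)`; Mathlib has no Kronecker
symbol at `2`). -/

/-- `(D/p) = 0` for a prime `p ∣ D`: `J(D | p) = 0`. [cite: LenstraPomerance1992, §2 (2.6) (p. 488)] -/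
theorem jacobiSym_eq_zero_of_prime_dvd {D : ℤ} {p : ℕ} (hp : p.Prime) (hpD : (p : ℤ) ∣ D) :
    jacobiSym D p = 0 := by
  haveI := Fact.mk hp
  rw [← jacobiSym.legendreSym.to_jacobiSym, legendreSym.eq_zero_iff]
  exact (ZMod.intCast_zmod_eq_zero_iff_dvd D p).mpr hpD

/-- `(D/p) = 1` for an odd prime `p ∈ 𝒫_D` (`D ≡ 0, 1 (mod 4)`): `J(D | p) = 1`.
[cite: LenstraPomerance1992, §2 (2.6)–(2.7) (p. 488)] -/
theorem jacobiSym_eq_one_of_mem_kroneckerOnePrimes {D : ℤ} (h4 : D % 4 = 0 ∨ D % 4 = 1) {p : ℕ}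
    (hp2 : p ≠ 2) (hP : p ∈ kroneckerOnePrimes D) : jacobiSym D p = 1 := by
  have hp : p.Prime := prime_of_mem_kroneckerOnePrimes hP
  haveI := Fact.mk hp
  obtain ⟨hpD, x, hx⟩ := (mem_kroneckerOnePrimes_iff_of_ne_two h4 hp hp2).mp hP
  have h0 : (D : ZMod p) ≠ 0 := fun h => hpD ((ZMod.intCast_zmod_eq_zero_iff_dvd D p).mp h)
  rw [← jacobiSym.legendreSym.to_jacobiSym, legendreSym.eq_one_iff p h0]
  refine ⟨(x : ZMod p), ?_⟩
  have h := (ZMod.intCast_eq_intCast_iff_dvd_sub D (x ^ 2) p).mpr hx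
  rw [h]; push_cast; ring

/-- `(D/p) = −1` for an odd prime `p ∤ D` with `p ∉ 𝒫_D` (`D ≡ 0, 1 (mod 4)`): `J(D | p) = −1`.
[cite: LenstraPomerance1992, §2 (2.6)–(2.7) (p. 488)] -/
theorem jacobiSym_eq_neg_one_of_not_mem_kroneckerOnePrimes {D : ℤ} (h4 : D % 4 = 0 ∨ D % 4 = 1)
    {p : ℕ} (hp : p.Prime) (hp2 : p ≠ 2) (hpD : ¬ (p : ℤ) ∣ D) (hP : p ∉ kroneckerOnePrimes D) :
    jacobiSym D p = -1 := by
  haveI := Fact.mk hp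
  rw [← jacobiSym.legendreSym.to_jacobiSym, legendreSym.eq_neg_one_iff]
  rintro ⟨r, hr⟩
  apply hP
  refine (mem_kroneckerOnePrimes_iff_of_ne_two h4 hp hp2).mpr ⟨hpD, (r.val : ℤ), ?_⟩
  refine (ZMod.intCast_eq_intCast_iff_dvd_sub D ((r.val : ℤ) ^ 2) p).mp ?_
  rw [hr]; push_cast
  rw [ZMod.natCast_zmod_val]; ring

end Literature.NumberTheory.QuadraticFields.BinaryQuadraticForm

namespace Literature.NumberTheory.QuadraticFields.Quadratic

namespace BinQF

open Finset Complex
open scoped LSeries.notation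

open Literature.NumberTheory.QuadraticFields.BinaryQuadraticForm (kroneckerOnePrimes
  mem_kroneckerOnePrimes prime_of_mem_kroneckerOnePrimes not_dvd_of_mem_kroneckerOnePrimes
  two_mem_kroneckerOnePrimes_iff mem_kroneckerOnePrimes_iff_of_ne_two)

section DirichletSeries

/-! ### `b (mod 2n)` versus the roots of `M² + βM + e` (as in `GaussRepresentationCount.lean`) -/

/-- `−d = β² − 4e` with `β ∈ {0, 1}` for `−d ≡ 0, 1 (mod 4)`. [folklore] -/
private theorem exists_beta_e' {d : ℕ} (h4 : (-(d : ℤ)) % 4 = 0 ∨ (-(d : ℤ)) % 4 = 1) :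
    ∃ (β : ℕ) (e : ℤ), (β = 0 ∨ β = 1) ∧ ((β : ℕ) : ℤ) ^ 2 - 4 * e = -(d : ℤ) := by
  rcases h4 with h0 | h1
  · exact ⟨0, (d : ℤ) / 4, Or.inl rfl, by push_cast; omega⟩
  · exact ⟨1, ((d : ℤ) + 1) / 4, Or.inr rfl, by push_cast; omega⟩

/-- `#{0 ≤ b < 2n : 4n ∣ b² + d} = #{0 ≤ M < n : n ∣ M² + βM + e}` when `−d = β² − 4e`, `β ∈ {0, 1}`
(`b = 2M + β`); the same computation as the private lemma of `GaussRepresentationCount.lean`.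
[folklore] -/
private theorem card_sqrtsMod_eq_card_qroots' {d β : ℕ} {e : ℤ} (hβ : β = 0 ∨ β = 1)
    (hde : ((β : ℕ) : ℤ) ^ 2 - 4 * e = -(d : ℤ)) (n : ℕ) :
    ((range (2 * n)).filter (fun b : ℕ => (4 * (n : ℤ)) ∣ (b : ℤ) ^ 2 + d)).card =
      (qroots (β : ℤ) e n).card := by
  have hpar : ∀ b : ℕ, (4 * (n : ℤ)) ∣ (b : ℤ) ^ 2 + d → b % 2 = β := by
    rintro b ⟨k, hk⟩
    have h4 : (4 : ℤ) ∣ (b : ℤ) ^ 2 + d := ⟨n * k, by rw [hk]; ring⟩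
    rcases Nat.even_or_odd b with ⟨t, ht⟩ | ⟨t, ht⟩
    · have hb : (b : ℤ) ^ 2 + d = 4 * ((t : ℤ) ^ 2) + d := by rw [ht]; push_cast; ring
      rw [hb] at h4
      have hd : (4 : ℤ) ∣ (d : ℤ) := (dvd_add_right (dvd_mul_right 4 ((t : ℤ) ^ 2))).mp h4
      rcases hβ with rfl | rfl
      · omega
      · exfalso; push_cast at hde; omega
    · have hb : (b : ℤ) ^ 2 + d = 4 * ((t : ℤ) ^ 2 + t) + (1 + d) := by rw [ht]; push_cast; ring
      rw [hb] at h4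
      have hd : (4 : ℤ) ∣ 1 + (d : ℤ) := (dvd_add_right (dvd_mul_right 4 ((t : ℤ) ^ 2 + t))).mp h4
      rcases hβ with rfl | rfl
      · exfalso; push_cast at hde; omega
      · omega
  refine card_bij' (fun b _ => b / 2) (fun M _ => 2 * M + β) ?_ ?_ ?_ ?_
  · intro b hb
    rw [mem_filter, mem_range] at hb
    obtain ⟨hb2n, hdiv⟩ := hb
    have hb' : (b : ℤ) = 2 * ((b / 2 : ℕ) : ℤ) + (β : ℕ) := by
      have := hpar b hdiv
      rcases hβ with rfl | rfl <;> push_cast <;> omega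
    rw [mem_qroots]
    refine ⟨by omega, ?_⟩
    obtain ⟨k, hk⟩ := hdiv
    refine ⟨k, Int.eq_of_mul_eq_mul_left (by norm_num : (4 : ℤ) ≠ 0) ?_⟩
    rw [hb'] at hk
    linear_combination hk - hde
  · intro M hM
    rw [mem_qroots] at hM
    obtain ⟨hMn, k, hk⟩ := hM
    rw [mem_filter, mem_range]
    refine ⟨by rcases hβ with rfl | rfl <;> omega, k, ?_⟩
    push_cast
    linear_combination 4 * hk + hde
  · intro b hb
    rw [mem_filter] at hb
    have := hpar b hb.2
    rcases hβ with rfl | rfl <;> omega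
  · intro M _
    rcases hβ with rfl | rfl <;> omega

/-- For a fundamental discriminant `D` and an odd prime `p`: `p² ∤ D`. [folklore] -/
private theorem not_sq_dvd_of_isFundamental' {D : ℤ}
    (hfd : (D % 4 = 1 ∧ Squarefree D ∧ D ≠ 1) ∨
      (4 ∣ D ∧ (D / 4 % 4 = 2 ∨ D / 4 % 4 = 3) ∧ Squarefree (D / 4)))
    {p : ℕ} (hp : p.Prime) (hp2 : p ≠ 2) : ¬ (p : ℤ) ^ 2 ∣ D := by
  have hpint : Prime (p : ℤ) := Nat.prime_iff_prime_int.mp hp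
  have hnu : ¬ IsUnit (p : ℤ) := hpint.not_unit
  intro h
  rw [sq] at h
  rcases hfd with ⟨-, hsf, -⟩ | ⟨h4, -, hsf⟩
  · exact hnu (hsf _ h)
  · apply hnu
    refine hsf _ ?_
    have hD : D = 4 * (D / 4) := by rw [mul_comm, Int.ediv_mul_cancel h4]
    rw [hD] at h
    have hcop : IsCoprime ((p : ℤ) * p) 4 := by
      have hc : IsCoprime (p : ℤ) 2 := by
        rw [Prime.coprime_iff_not_dvd hpint]
        intro h2
        have h' : p ∣ 2 := by exact_mod_cast h2
        exact hp2 ((Nat.prime_dvd_prime_iff_eq hp Nat.prime_two).mp h')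
      have h4' : (4 : ℤ) = 2 ^ 2 := by norm_num
      rw [h4']
      exact (hc.mul_left hc).pow_right
    exact hcop.dvd_of_dvd_mul_left h

/-- An even fundamental discriminant is `≡ 8` or `12 (mod 16)`. [folklore] -/
private theorem emod_sixteen_of_isFundamental' {D : ℤ}
    (hfd : (D % 4 = 1 ∧ Squarefree D ∧ D ≠ 1) ∨
      (4 ∣ D ∧ (D / 4 % 4 = 2 ∨ D / 4 % 4 = 3) ∧ Squarefree (D / 4)))
    (h2 : (2 : ℤ) ∣ D) : D % 16 = 8 ∨ D % 16 = 12 := by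
  rcases hfd with ⟨h1, -, -⟩ | ⟨h4, h23, -⟩
  · exfalso; obtain ⟨c, hc⟩ := h2; omega
  · obtain ⟨c, hc⟩ := h4; subst hc; omega

/-- `−d ≡ 0, 1 (mod 4)` for a fundamental `−d`. [folklore] -/
private theorem emod_four_of_isFundamental {d : ℕ}
    (hfd : ((-(d : ℤ)) % 4 = 1 ∧ Squarefree (-(d : ℤ)) ∧ (-(d : ℤ)) ≠ 1) ∨
      (4 ∣ (-(d : ℤ)) ∧ ((-(d : ℤ)) / 4 % 4 = 2 ∨ (-(d : ℤ)) / 4 % 4 = 3) ∧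
        Squarefree ((-(d : ℤ)) / 4))) :
    (-(d : ℤ)) % 4 = 0 ∨ (-(d : ℤ)) % 4 = 1 := by
  rcases hfd with ⟨h1, -, -⟩ | ⟨h4, -, -⟩
  · exact Or.inr h1
  · left; omega

/-! ### `ρ_d(n) = #{b (mod 2n) : b² ≡ −d (mod 4n)}` is multiplicative -/

/-- `ρ_d(1) = 1` for `−d ≡ 0, 1 (mod 4)`: exactly one of `b = 0, 1` has `b² ≡ −d (mod 4)`.
[cite: Oesterle1988Gauss, II §1 Corollaire p. 54] -/
theorem card_sqrtsMod_one {d : ℕ} (h4 : (-(d : ℤ)) % 4 = 0 ∨ (-(d : ℤ)) % 4 = 1) :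
    ((range (2 * 1)).filter (fun b : ℕ => (4 * ((1 : ℕ) : ℤ)) ∣ (b : ℤ) ^ 2 + d)).card = 1 := by
  obtain ⟨β, e, hβ, hde⟩ := exists_beta_e' h4
  rw [card_sqrtsMod_eq_card_qroots' hβ hde 1]
  exact card_qroots_eq_one_of_squarefree squarefree_one (one_dvd _)

/-- **`ρ_d` is multiplicative**: `ρ_d(mn) = ρ_d(m) ρ_d(n)` for coprime `m, n` — «En décomposant
Z/4nZ en ses composantes primaires» (the Chinese remainder theorem, `card_qroots_mul`).
[cite: Oesterle1988Gauss, II §1 p. 54 (proof of the Corollaire)] -/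
theorem card_sqrtsMod_mul {d : ℕ} (h4 : (-(d : ℤ)) % 4 = 0 ∨ (-(d : ℤ)) % 4 = 1) {m n : ℕ}
    (hmn : m.Coprime n) :
    ((range (2 * (m * n))).filter (fun b : ℕ => (4 * ((m * n : ℕ) : ℤ)) ∣ (b : ℤ) ^ 2 + d)).card =
      ((range (2 * m)).filter (fun b : ℕ => (4 * (m : ℤ)) ∣ (b : ℤ) ^ 2 + d)).card *
        ((range (2 * n)).filter (fun b : ℕ => (4 * (n : ℤ)) ∣ (b : ℤ) ^ 2 + d)).card := by
  obtain ⟨β, e, hβ, hde⟩ := exists_beta_e' h4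
  rcases Nat.eq_zero_or_pos m with rfl | hm
  · simp
  rcases Nat.eq_zero_or_pos n with rfl | hn
  · simp
  rw [card_sqrtsMod_eq_card_qroots' hβ hde (m * n), card_sqrtsMod_eq_card_qroots' hβ hde m,
    card_sqrtsMod_eq_card_qroots' hβ hde n]
  exact card_qroots_mul hmn hm hn

/-! ### Local values at prime powers (the Corollaire) -/

/-- **Split primes**: `ρ_d(p^k) = 2` for `p ∈ 𝒫_{−d}` and `k ≥ 1`.
[cite: Oesterle1988Gauss, II §1 Corollaire p. 54] -/
theorem card_sqrtsMod_prime_pow_of_mem {d : ℕ} (h4 : (-(d : ℤ)) % 4 = 0 ∨ (-(d : ℤ)) % 4 = 1)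
    {p k : ℕ} (hk : 0 < k) (hp : p ∈ kroneckerOnePrimes (-(d : ℤ))) :
    ((range (2 * p ^ k)).filter (fun b : ℕ => (4 * ((p ^ k : ℕ) : ℤ)) ∣ (b : ℤ) ^ 2 + d)).card
      = 2 := by
  have hpp : p.Prime := prime_of_mem_kroneckerOnePrimes hp
  have h := card_sqrtsMod_eq_two_pow h4 (d' := 1) (m := p ^ k) squarefree_one (one_dvd d)
    (pow_pos hpp.pos k) (fun q hq => by
      rw [Nat.primeFactors_prime_pow hk.ne' hpp, mem_singleton] at hq
      rw [hq]; exact hp)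
  rw [Nat.primeFactors_prime_pow hk.ne' hpp, card_singleton, pow_one, one_mul] at h
  exact h

/-- **Ramified primes, exponent one**: `ρ_d(p) = 1` for a prime `p ∣ d`.
[cite: Oesterle1988Gauss, II §1 Corollaire p. 54] -/
theorem card_sqrtsMod_prime_of_dvd {d : ℕ} (h4 : (-(d : ℤ)) % 4 = 0 ∨ (-(d : ℤ)) % 4 = 1)
    {p : ℕ} (hp : p.Prime) (hpd : p ∣ d) :
    ((range (2 * p)).filter (fun b : ℕ => (4 * (p : ℤ)) ∣ (b : ℤ) ^ 2 + d)).card = 1 := by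
  obtain ⟨β, e, hβ, hde⟩ := exists_beta_e' h4
  rw [card_sqrtsMod_eq_card_qroots' hβ hde p]
  refine card_qroots_prime_eq_one hp ?_
  rw [hde, dvd_neg]
  exact Int.natCast_dvd_natCast.mpr hpd

/-- **Ramified primes, exponent `≥ 2`**: `ρ_d(p^k) = 0` for a prime `p ∣ d` and `k ≥ 2`, when `−d`
is a fundamental discriminant («d′ … sans facteurs carrés»).
[cite: Oesterle1988Gauss, II §1 Corollaire p. 54] -/
theorem card_sqrtsMod_prime_pow_of_dvd {d : ℕ}
    (hfd : ((-(d : ℤ)) % 4 = 1 ∧ Squarefree (-(d : ℤ)) ∧ (-(d : ℤ)) ≠ 1) ∨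
      (4 ∣ (-(d : ℤ)) ∧ ((-(d : ℤ)) / 4 % 4 = 2 ∨ (-(d : ℤ)) / 4 % 4 = 3) ∧
        Squarefree ((-(d : ℤ)) / 4)))
    {p k : ℕ} (hp : p.Prime) (hk : 2 ≤ k) (hpd : p ∣ d) :
    ((range (2 * p ^ k)).filter (fun b : ℕ => (4 * ((p ^ k : ℕ) : ℤ)) ∣ (b : ℤ) ^ 2 + d)).card
      = 0 := by
  obtain ⟨β, e, hβ, hde⟩ := exists_beta_e' (emod_four_of_isFundamental hfd)
  rw [card_sqrtsMod_eq_card_qroots' hβ hde (p ^ k), card_eq_zero]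
  have hfd' := hfd
  rw [← hde] at hfd'
  have hD : (p : ℤ) ∣ ((β : ℕ) : ℤ) ^ 2 - 4 * e := by
    rw [hde, dvd_neg]; exact Int.natCast_dvd_natCast.mpr hpd
  exact qroots_prime_pow_eq_empty_of_dvd hp hk hD
    (fun hp2 => not_sq_dvd_of_isFundamental' hfd' hp hp2)
    (fun hp2 => emod_sixteen_of_isFundamental' hfd' (by rw [hp2] at hD; exact_mod_cast hD))

/-- **Inert primes**: `ρ_d(p^k) = 0` for a prime `p ∤ d`, `p ∉ 𝒫_{−d}`, and `k ≥ 1`.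
[cite: Oesterle1988Gauss, II §1 Corollaire p. 54] -/
theorem card_sqrtsMod_prime_pow_of_not_mem {d : ℕ} (h4 : (-(d : ℤ)) % 4 = 0 ∨ (-(d : ℤ)) % 4 = 1)
    {p k : ℕ} (hp : p.Prime) (hk : 0 < k) (hpd : ¬ p ∣ d) (hP : p ∉ kroneckerOnePrimes (-(d : ℤ))) :
    ((range (2 * p ^ k)).filter (fun b : ℕ => (4 * ((p ^ k : ℕ) : ℤ)) ∣ (b : ℤ) ^ 2 + d)).card
      = 0 := by
  obtain ⟨β, e, hβ, hde⟩ := exists_beta_e' h4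
  rw [card_sqrtsMod_eq_card_qroots' hβ hde (p ^ k), card_eq_zero]
  have hD : ¬ (p : ℤ) ∣ ((β : ℕ) : ℤ) ^ 2 - 4 * e := by
    rw [hde, dvd_neg]; exact fun h => hpd (Int.natCast_dvd_natCast.mp h)
  have hP' : p ∉ kroneckerOnePrimes (((β : ℕ) : ℤ) ^ 2 - 4 * e) := by rw [hde]; exact hP
  exact qroots_prime_pow_eq_empty_of_not_mem hp hk hD hP'

/-! ### The size of `ρ_d(n)`: at most the number of divisors -/

/-- `ρ_d(n) ≤ d(n)` (number of divisors) for `n ≥ 1` and a negative fundamental `−d`: by the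
Corollaire `ρ_d(n)` is `0` or `2^{ω(m)}` with `m ∣ n`, and `2^{ω(m)} ≤ d(m) ≤ d(n)`.
[cite: Oesterle1988Gauss, II §1 Corollaire p. 54] -/
theorem card_sqrtsMod_le_card_divisors {d : ℕ}
    (hfd : ((-(d : ℤ)) % 4 = 1 ∧ Squarefree (-(d : ℤ)) ∧ (-(d : ℤ)) ≠ 1) ∨
      (4 ∣ (-(d : ℤ)) ∧ ((-(d : ℤ)) / 4 % 4 = 2 ∨ (-(d : ℤ)) / 4 % 4 = 3) ∧
        Squarefree ((-(d : ℤ)) / 4)))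
    {n : ℕ} (hn : 0 < n) :
    ((range (2 * n)).filter (fun b : ℕ => (4 * (n : ℤ)) ∣ (b : ℤ) ^ 2 + d)).card ≤
      n.divisors.card := by
  by_cases h0 : ((range (2 * n)).filter (fun b : ℕ => (4 * (n : ℤ)) ∣ (b : ℤ) ^ 2 + d)).card = 0
  · rw [h0]; exact Nat.zero_le _
  obtain ⟨d', m, hnm, hsf, hd'd, hm⟩ := (card_sqrtsMod_ne_zero_iff hfd hn).mp h0
  have hm0 : 0 < m := Nat.pos_of_ne_zero (by rintro rfl; rw [mul_zero] at hnm; omega)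
  have h4 := emod_four_of_isFundamental hfd
  subst hnm
  rw [card_sqrtsMod_eq_two_pow h4 hsf hd'd hm0 hm]
  calc 2 ^ m.primeFactors.card ≤ m.divisors.card := by
        rw [Nat.card_divisors hm0.ne']
        exact Finset.pow_card_le_prod _ _ _ (fun p hp => by
          have := (Nat.Prime.factorization_pos_of_dvd (Nat.prime_of_mem_primeFactors hp) hm0.ne'
            (Nat.dvd_of_mem_primeFactors hp))
          omega)
    _ ≤ (d' * m).divisors.card :=
        card_le_card (Nat.divisors_subset_of_dvd hn.ne' (dvd_mul_left m d'))

/-- **Absolute convergence for `Re s > 1`** of `Σ ρ_d(n) n^{−s}` (comparison with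
`Σ d(n) n^{−σ} = ζ(σ)²`). [cite: Oesterle1988Gauss, II §2 (25) p. 56] -/
theorem LSeriesSummable_card_sqrtsMod {d : ℕ}
    (hfd : ((-(d : ℤ)) % 4 = 1 ∧ Squarefree (-(d : ℤ)) ∧ (-(d : ℤ)) ≠ 1) ∨
      (4 ∣ (-(d : ℤ)) ∧ ((-(d : ℤ)) / 4 % 4 = 2 ∨ (-(d : ℤ)) / 4 % 4 = 3) ∧
        Squarefree ((-(d : ℤ)) / 4)))
    {s : ℂ} (hs : 1 < s.re) :
    LSeriesSummable
      (fun n : ℕ => ((((range (2 * n)).filter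
        (fun b : ℕ => (4 * (n : ℤ)) ∣ (b : ℤ) ^ 2 + d)).card : ℕ) : ℂ)) s := by
  -- the majorant `Σ d(n) n^{-s}` is the square of `Σ n^{-s}`
  have h1 : LSeriesSummable (1 : ℕ → ℂ) s := LSeriesSummable_one_iff.mpr hs
  have hdiv : LSeriesSummable ((1 : ℕ → ℂ) ⍟ (1 : ℕ → ℂ)) s := h1.convolution h1
  have hdiv' : Summable fun n : ℕ => ‖LSeries.term ((1 : ℕ → ℂ) ⍟ (1 : ℕ → ℂ)) s n‖ :=
    summable_norm_iff.mpr hdiv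
  have hconv : ∀ n : ℕ, n ≠ 0 → ((1 : ℕ → ℂ) ⍟ (1 : ℕ → ℂ)) n = (n.divisors.card : ℂ) := by
    intro n hn
    rw [LSeries.convolution_def]
    simp only [Pi.one_apply, mul_one, sum_const, nsmul_eq_mul]
    rw [← Nat.map_div_right_divisors, card_map]
  unfold LSeriesSummable
  refine summable_norm_iff.mp (Summable.of_nonneg_of_le (fun n => norm_nonneg _) (fun n => ?_) hdiv')
  rcases Nat.eq_zero_or_pos n with rfl | hn
  · simp
  rw [LSeries.term_of_ne_zero hn.ne', LSeries.term_of_ne_zero hn.ne', norm_div, norm_div,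
    hconv n hn.ne', Complex.norm_natCast, Complex.norm_natCast]
  exact div_le_div_of_nonneg_right (by exact_mod_cast card_sqrtsMod_le_card_divisors hfd hn)
    (norm_nonneg _)

/-! ### The local factor `Σ_e ρ_d(p^e) x^e = (1 + x)/(1 − χ(p) x)` -/

/-- **The local factor of (25).** For a negative fundamental `−d`, a prime `p`, the Kronecker
symbol `χ(p) = (−d/p) ∈ {1, 0, −1}` and `‖x‖ < 1`:
`Σ_{e ≥ 0} ρ_d(p^e) x^e = (1 + x) / (1 − χ(p) x)` (`= (1 + x)/(1 − x)`, `1 + x`, `1` in the three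
cases split / ramified / inert). [cite: Oesterle1988Gauss, II §2 (25) p. 56] -/
theorem hasSum_card_sqrtsMod_prime_pow_mul {d : ℕ}
    (hfd : ((-(d : ℤ)) % 4 = 1 ∧ Squarefree (-(d : ℤ)) ∧ (-(d : ℤ)) ≠ 1) ∨
      (4 ∣ (-(d : ℤ)) ∧ ((-(d : ℤ)) / 4 % 4 = 2 ∨ (-(d : ℤ)) / 4 % 4 = 3) ∧
        Squarefree ((-(d : ℤ)) / 4)))
    {p : ℕ} (hp : p.Prime) {χp : ℂ}
    (hχ0 : p ∣ d → χp = 0) (hχ1 : p ∈ kroneckerOnePrimes (-(d : ℤ)) → χp = 1)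
    (hχ2 : ¬ p ∣ d → p ∉ kroneckerOnePrimes (-(d : ℤ)) → χp = -1)
    {x : ℂ} (hx : ‖x‖ < 1) :
    HasSum (fun e : ℕ => ((((range (2 * p ^ e)).filter
        (fun b : ℕ => (4 * ((p ^ e : ℕ) : ℤ)) ∣ (b : ℤ) ^ 2 + d)).card : ℕ) : ℂ) * x ^ e)
      ((1 + x) / (1 - χp * x)) := by
  have h4 := emod_four_of_isFundamental hfd
  have h0 : ((((range (2 * p ^ 0)).filter
      (fun b : ℕ => (4 * ((p ^ 0 : ℕ) : ℤ)) ∣ (b : ℤ) ^ 2 + d)).card : ℕ) : ℂ) = 1 := by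
    have := card_sqrtsMod_one h4
    rw [pow_zero]
    exact_mod_cast this
  have hx1 : 1 - x ≠ 0 := by
    intro h
    have : x = 1 := by linear_combination -h
    rw [this, norm_one] at hx
    exact lt_irrefl _ hx
  have hx1' : 1 + x ≠ 0 := by
    intro h
    have : x = -1 := by linear_combination h
    rw [this, norm_neg, norm_one] at hx
    exact lt_irrefl _ hx
  by_cases hpd : p ∣ d
  · -- ramified: `1 + x`
    rw [hχ0 hpd, zero_mul, sub_zero, div_one]
    have h1 : ((((range (2 * p ^ 1)).filter
        (fun b : ℕ => (4 * ((p ^ 1 : ℕ) : ℤ)) ∣ (b : ℤ) ^ 2 + d)).card : ℕ) : ℂ) = 1 := by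
      have := card_sqrtsMod_prime_of_dvd h4 hp hpd
      rw [pow_one]
      exact_mod_cast this
    set g : ℕ → ℂ := (fun e : ℕ => ((((range (2 * p ^ e)).filter
        (fun b : ℕ => (4 * ((p ^ e : ℕ) : ℤ)) ∣ (b : ℤ) ^ 2 + d)).card : ℕ) : ℂ) * x ^ e) with hg
    have hfin : ∀ e ∉ ({0, 1} : Finset ℕ), g e = 0 := by
      intro e he
      rw [mem_insert, mem_singleton, not_or] at he
      simp only [hg]
      rw [card_sqrtsMod_prime_pow_of_dvd hfd hp (by omega) hpd]
      simp
    have H : HasSum g (∑ e ∈ ({0, 1} : Finset ℕ), g e) := hasSum_sum_of_ne_finset_zero hfin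
    have hg0 : g 0 = 1 := by simp only [hg]; rw [h0, pow_zero, mul_one]
    have hg1 : g 1 = x := by simp only [hg]; rw [h1, pow_one, one_mul]
    rw [sum_pair (by norm_num), hg0, hg1] at H
    exact H
  by_cases hP : p ∈ kroneckerOnePrimes (-(d : ℤ))
  · -- split: `(1 + x)/(1 - x) = 2 (1 - x)⁻¹ - 1`
    rw [hχ1 hP, one_mul]
    have hgeom : HasSum (fun e : ℕ => 2 * x ^ e) (2 * (1 - x)⁻¹) :=
      (hasSum_geometric_of_norm_lt_one hx).mul_left 2
    have hδ : HasSum (fun e : ℕ => if e = 0 then (-1 : ℂ) else 0) (-1) := hasSum_ite_eq 0 (-1)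
    have H := hgeom.add hδ
    have hfun : (fun e : ℕ => ((((range (2 * p ^ e)).filter
        (fun b : ℕ => (4 * ((p ^ e : ℕ) : ℤ)) ∣ (b : ℤ) ^ 2 + d)).card : ℕ) : ℂ) * x ^ e) =
        fun e : ℕ => 2 * x ^ e + (if e = 0 then (-1 : ℂ) else 0) := by
      funext e
      rcases Nat.eq_zero_or_pos e with rfl | he
      · rw [h0]; norm_num
      · rw [card_sqrtsMod_prime_pow_of_mem h4 he hP, if_neg he.ne']
        push_cast; ring
    have hval : (1 + x) / (1 - x) = 2 * (1 - x)⁻¹ + -1 := by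
      field_simp
      ring
    rw [hfun, hval]
    exact H
  · -- inert: `1`
    rw [hχ2 hpd hP]
    have hval : (1 + x) / (1 - (-1) * x) = 1 := by
      rw [neg_one_mul, sub_neg_eq_add, div_self hx1']
    rw [hval]
    set g : ℕ → ℂ := (fun e : ℕ => ((((range (2 * p ^ e)).filter
        (fun b : ℕ => (4 * ((p ^ e : ℕ) : ℤ)) ∣ (b : ℤ) ^ 2 + d)).card : ℕ) : ℂ) * x ^ e) with hg
    have hfin : ∀ e ∉ ({0} : Finset ℕ), g e = 0 := by
      intro e he
      rw [mem_singleton] at he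
      simp only [hg]
      rw [card_sqrtsMod_prime_pow_of_not_mem h4 hp (Nat.pos_of_ne_zero he) hpd hP]
      simp
    have H : HasSum g (∑ e ∈ ({0} : Finset ℕ), g e) := hasSum_sum_of_ne_finset_zero hfin
    have hg0 : g 0 = 1 := by simp only [hg]; rw [h0, pow_zero, mul_one]
    rw [sum_singleton, hg0] at H
    exact H

/-! ### (25): `Σ_{n ≥ 1} ρ_d(n) n^{−s} = Π_p (1 + p^{−s})/(1 − χ(p) p^{−s})` -/

/-- **Oesterlé 1988, II §2, (25), as printed** («Le théorème de Gauss …, ou plutôt son corollaire,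
traduit alors l'égalité entre séries de Dirichlet Σ_{n=1}^∞ r_n(−d) n^{−s} =
Π_{p premier} (1 + p^{−s})/(1 − χ(p) p^{−s})»), `HasProd` form: for a negative fundamental
discriminant `−d`, `χ` with the Kronecker values `(−d/p)` at primes, and `Re s > 1`, the Euler
product `Π_p (1 + p^{−s})/(1 − χ(p) p^{−s})` converges to `Σ_{n ≥ 1} ρ_d(n) n^{−s}`,
`ρ_d(n) = #{b (mod 2n) : b² ≡ −d (mod 4n)}` (`= r_n(−d)`, Théorème p. 54).
[cite: Oesterle1988Gauss, II §2 (25) p. 56] -/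
theorem LSeries_card_sqrtsMod_eulerProduct_hasProd {d : ℕ}
    (hfd : ((-(d : ℤ)) % 4 = 1 ∧ Squarefree (-(d : ℤ)) ∧ (-(d : ℤ)) ≠ 1) ∨
      (4 ∣ (-(d : ℤ)) ∧ ((-(d : ℤ)) / 4 % 4 = 2 ∨ (-(d : ℤ)) / 4 % 4 = 3) ∧
        Squarefree ((-(d : ℤ)) / 4)))
    (χ : ℕ → ℂ) (hχ0 : ∀ p : ℕ, p.Prime → p ∣ d → χ p = 0)
    (hχ1 : ∀ p ∈ kroneckerOnePrimes (-(d : ℤ)), χ p = 1)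
    (hχ2 : ∀ p : ℕ, p.Prime → ¬ p ∣ d → p ∉ kroneckerOnePrimes (-(d : ℤ)) → χ p = -1)
    {s : ℂ} (hs : 1 < s.re) :
    HasProd (fun p : Nat.Primes => (1 + (p : ℂ) ^ (-s)) / (1 - χ p * (p : ℂ) ^ (-s)))
      (LSeries (fun n : ℕ => ((((range (2 * n)).filter
        (fun b : ℕ => (4 * (n : ℤ)) ∣ (b : ℤ) ^ 2 + d)).card : ℕ) : ℂ)) s) := by
  have h4 := emod_four_of_isFundamental hfd
  set ρ : ℕ → ℂ := fun n : ℕ => ((((range (2 * n)).filter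
        (fun b : ℕ => (4 * (n : ℤ)) ∣ (b : ℤ) ^ 2 + d)).card : ℕ) : ℂ) with hρ
  have hρ0 : ρ 0 = 0 := by simp [hρ]
  -- the summand `f(n) = ρ(n) n^{-s}`
  set f : ℕ → ℂ := fun n => ρ n * (n : ℂ) ^ (-s) with hf
  have hterm : ∀ n, LSeries.term ρ s n = f n := fun n => LSeries.term_def₀ hρ0 s n
  have hf0 : f 0 = 0 := by simp [hf, hρ0]
  have hf1 : f 1 = 1 := by
    have h := card_sqrtsMod_one (d := d) h4
    show ((((range (2 * 1)).filter
        (fun b : ℕ => (4 * ((1 : ℕ) : ℤ)) ∣ (b : ℤ) ^ 2 + d)).card : ℕ) : ℂ) *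
      ((1 : ℕ) : ℂ) ^ (-s) = 1
    rw [h, Nat.cast_one, one_cpow, mul_one]
  have hmul : ∀ {m n : ℕ}, m.Coprime n → f (m * n) = f m * f n := by
    intro m n hmn
    show ρ (m * n) * ((m * n : ℕ) : ℂ) ^ (-s) = ρ m * (m : ℂ) ^ (-s) * (ρ n * (n : ℂ) ^ (-s))
    simp only [hρ]
    rw [card_sqrtsMod_mul h4 hmn]
    push_cast
    rw [Complex.natCast_mul_natCast_cpow]
    ring
  have hsum : Summable fun n => ‖f n‖ := by
    have := summable_norm_iff.mpr (LSeriesSummable_card_sqrtsMod hfd hs)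
    refine this.congr fun n => ?_
    rw [hterm]
  have hLS : LSeries ρ s = ∑' n, f n := tsum_congr hterm
  have key : HasProd (fun p : Nat.Primes => ∑' e : ℕ, f ((p : ℕ) ^ e)) (LSeries ρ s) := by
    rw [hLS]
    exact EulerProduct.eulerProduct_hasProd hf1 hmul hsum hf0
  have hF : (fun p : Nat.Primes => (1 + ((p : ℕ) : ℂ) ^ (-s)) / (1 - χ p * ((p : ℕ) : ℂ) ^ (-s)))
      = fun p : Nat.Primes => ∑' e : ℕ, f ((p : ℕ) ^ e) := by
    funext p
    have hpp : (p : ℕ).Prime := p.prop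
    -- `‖p^{-s}‖ < 1`
    have hx : ‖((p : ℕ) : ℂ) ^ (-s)‖ < 1 := by
      rw [Complex.norm_natCast_cpow_of_pos hpp.pos, neg_re]
      exact Real.rpow_lt_one_of_one_lt_of_neg (by exact_mod_cast hpp.one_lt) (by linarith)
    have hloc := hasSum_card_sqrtsMod_prime_pow_mul hfd hpp (hχ0 p hpp) (hχ1 p) (hχ2 p hpp) hx
    -- `f(p^e) = ρ(p^e) (p^{-s})^e`
    have hpow : ∀ e : ℕ, ((((p : ℕ) ^ e : ℕ) : ℂ)) ^ (-s) = ((((p : ℕ) : ℂ)) ^ (-s)) ^ e := by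
      intro e
      induction e with
      | zero => simp
      | succ e ih => rw [pow_succ, Nat.cast_mul, Complex.natCast_mul_natCast_cpow, ih, pow_succ]
    have hfe : ∀ e : ℕ, f ((p : ℕ) ^ e) = ((((range (2 * (p : ℕ) ^ e)).filter
        (fun b : ℕ => (4 * (((p : ℕ) ^ e : ℕ) : ℤ)) ∣ (b : ℤ) ^ 2 + d)).card : ℕ) : ℂ) *
          ((((p : ℕ) : ℂ)) ^ (-s)) ^ e := by
      intro e
      show ρ ((p : ℕ) ^ e) * ((((p : ℕ) ^ e : ℕ) : ℂ)) ^ (-s) = _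
      rw [hpow e]
    rw [tsum_congr hfe, hloc.tsum_eq]
  rw [hF]
  exact key

/-- **Oesterlé 1988, II §2, (25), as printed**, equality form:
`Σ_{n ≥ 1} ρ_d(n) n^{−s} = Π_{p prime} (1 + p^{−s}) / (1 − χ(p) p^{−s})` for `Re s > 1`, where
`ρ_d(n) = #{b (mod 2n) : b² ≡ −d (mod 4n)} = r_n(−d)` and `χ(p) = (−d/p)`.
[cite: Oesterle1988Gauss, II §2 (25) p. 56] -/
theorem LSeries_card_sqrtsMod_eq_eulerProduct {d : ℕ}
    (hfd : ((-(d : ℤ)) % 4 = 1 ∧ Squarefree (-(d : ℤ)) ∧ (-(d : ℤ)) ≠ 1) ∨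
      (4 ∣ (-(d : ℤ)) ∧ ((-(d : ℤ)) / 4 % 4 = 2 ∨ (-(d : ℤ)) / 4 % 4 = 3) ∧
        Squarefree ((-(d : ℤ)) / 4)))
    (χ : ℕ → ℂ) (hχ0 : ∀ p : ℕ, p.Prime → p ∣ d → χ p = 0)
    (hχ1 : ∀ p ∈ kroneckerOnePrimes (-(d : ℤ)), χ p = 1)
    (hχ2 : ∀ p : ℕ, p.Prime → ¬ p ∣ d → p ∉ kroneckerOnePrimes (-(d : ℤ)) → χ p = -1)
    {s : ℂ} (hs : 1 < s.re) :
    LSeries (fun n : ℕ => ((((range (2 * n)).filter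
        (fun b : ℕ => (4 * (n : ℤ)) ∣ (b : ℤ) ^ 2 + d)).card : ℕ) : ℂ)) s =
      ∏' p : Nat.Primes, (1 + (p : ℂ) ^ (-s)) / (1 - χ p * (p : ℂ) ^ (-s)) :=
  (LSeries_card_sqrtsMod_eulerProduct_hasProd hfd χ hχ0 hχ1 hχ2 hs).tprod_eq.symm

/-- **(25) with `r_n(−d) = Σ_{C ∈ Cl(−d)} r_n(C)`** (Oesterlé's (12), (14): `r_n(q) = ½ #{(u, v)
coprime : q(u, v) = n}`, so `r_n(−d) = ½ Σ_{q_i ∈ repForms(−d)} #reps(q_i, n)`), for `d > 4`: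
`Σ_{n ≥ 1} r_n(−d) n^{−s} = Π_p (1 + p^{−s})/(1 − χ(p) p^{−s})`, `Re s > 1`.
[cite: Oesterle1988Gauss, II §2 (25) p. 56; II §1 Théorème p. 54] -/
theorem LSeries_sum_card_reps_eq_eulerProduct {d : ℕ} (hd4 : 4 < d)
    (hfd : ((-(d : ℤ)) % 4 = 1 ∧ Squarefree (-(d : ℤ)) ∧ (-(d : ℤ)) ≠ 1) ∨
      (4 ∣ (-(d : ℤ)) ∧ ((-(d : ℤ)) / 4 % 4 = 2 ∨ (-(d : ℤ)) / 4 % 4 = 3) ∧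
        Squarefree ((-(d : ℤ)) / 4)))
    (χ : ℕ → ℂ) (hχ0 : ∀ p : ℕ, p.Prime → p ∣ d → χ p = 0)
    (hχ1 : ∀ p ∈ kroneckerOnePrimes (-(d : ℤ)), χ p = 1)
    (hχ2 : ∀ p : ℕ, p.Prime → ¬ p ∣ d → p ∉ kroneckerOnePrimes (-(d : ℤ)) → χ p = -1)
    {s : ℂ} (hs : 1 < s.re) :
    LSeries (fun n : ℕ => ((∑ R ∈ repForms (-(d : ℤ)), (reps R n).card : ℕ) : ℂ) / 2) s =
      ∏' p : Nat.Primes, (1 + (p : ℂ) ^ (-s)) / (1 - χ p * (p : ℂ) ^ (-s)) := by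
  rw [← LSeries_card_sqrtsMod_eq_eulerProduct hfd χ hχ0 hχ1 hχ2 hs]
  refine LSeries_congr (fun {n} hn => ?_) s
  rw [← two_mul_card_sqrtsMod_eq_sum_card_reps hd4 hfd (Nat.pos_of_ne_zero hn)]
  push_cast
  ring

/-! ### «ou encore … (26)»: `ζ(2s) Σ ρ_d(n) n^{−s} = ζ(s) L(χ, s)` -/

/-- **From (25) to (26)** (Oesterlé: «ou encore, compte tenu de (23), l'égalité (26)
ζ_K(s) = ζ(s) L(χ, s)», with (23) `ζ_K(s) = ζ(2s) Σ r_n(−d) n^{−s}`): for a Dirichlet character `κ`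
(any modulus) whose values at primes are the Kronecker symbols `(−d/p)`, and `Re s > 1`,
`ζ(2s) · Σ_{n ≥ 1} ρ_d(n) n^{−s} = ζ(s) · L(κ, s)` — the Euler factors multiply as
`(1 − p^{−2s})^{−1} (1 + p^{−s}) (1 − χ(p)p^{−s})^{−1} = (1 − p^{−s})^{−1} (1 − χ(p)p^{−s})^{−1}`.
[cite: Oesterle1988Gauss, II §2 (25)–(26) p. 56] -/
theorem riemannZeta_mul_LSeries_card_sqrtsMod {d : ℕ}
    (hfd : ((-(d : ℤ)) % 4 = 1 ∧ Squarefree (-(d : ℤ)) ∧ (-(d : ℤ)) ≠ 1) ∨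
      (4 ∣ (-(d : ℤ)) ∧ ((-(d : ℤ)) / 4 % 4 = 2 ∨ (-(d : ℤ)) / 4 % 4 = 3) ∧
        Squarefree ((-(d : ℤ)) / 4)))
    {N : ℕ} (κ : DirichletCharacter ℂ N) (hκ0 : ∀ p : ℕ, p.Prime → p ∣ d → κ p = 0)
    (hκ1 : ∀ p ∈ kroneckerOnePrimes (-(d : ℤ)), κ p = 1)
    (hκ2 : ∀ p : ℕ, p.Prime → ¬ p ∣ d → p ∉ kroneckerOnePrimes (-(d : ℤ)) → κ p = -1)
    {s : ℂ} (hs : 1 < s.re) :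
    riemannZeta (2 * s) * LSeries (fun n : ℕ => ((((range (2 * n)).filter
        (fun b : ℕ => (4 * (n : ℤ)) ∣ (b : ℤ) ^ 2 + d)).card : ℕ) : ℂ)) s =
      riemannZeta s * L ↗κ s := by
  have hs2 : 1 < (2 * s).re := by simp; linarith
  have hζ2 := riemannZeta_eulerProduct_hasProd hs2
  have hζ := riemannZeta_eulerProduct_hasProd hs
  have hL := DirichletCharacter.LSeries_eulerProduct_hasProd κ hs
  have h25 := LSeries_card_sqrtsMod_eulerProduct_hasProd hfd (fun n : ℕ => κ n) hκ0 hκ1 hκ2 hs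
  have hlhs := hζ2.mul h25
  have hrhs : HasProd (fun p : Nat.Primes =>
      (1 - ((p : ℕ) : ℂ) ^ (-s))⁻¹ * (1 - κ p * ((p : ℕ) : ℂ) ^ (-s))⁻¹)
      (riemannZeta s * L ↗κ s) := hζ.mul hL
  -- the Euler factors agree
  have hF : (fun p : Nat.Primes =>
      (1 - ((p : ℕ) : ℂ) ^ (-s))⁻¹ * (1 - κ p * ((p : ℕ) : ℂ) ^ (-s))⁻¹) =
      fun p : Nat.Primes => (1 - ((p : ℕ) : ℂ) ^ (-(2 * s)))⁻¹ *
        ((1 + ((p : ℕ) : ℂ) ^ (-s)) / (1 - κ p * ((p : ℕ) : ℂ) ^ (-s))) := by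
    funext p
    have hpp : (p : ℕ).Prime := p.prop
    set x : ℂ := ((p : ℕ) : ℂ) ^ (-s) with hxdef
    have hx : ‖x‖ < 1 := by
      rw [hxdef, Complex.norm_natCast_cpow_of_pos hpp.pos, neg_re]
      exact Real.rpow_lt_one_of_one_lt_of_neg (by exact_mod_cast hpp.one_lt) (by linarith)
    have hx2 : ((p : ℕ) : ℂ) ^ (-(2 * s)) = x ^ 2 := by
      rw [hxdef, ← Complex.cpow_nat_mul]
      congr 1
      push_cast
      ring
    have hx1 : 1 - x ≠ 0 := by
      intro h
      have : x = 1 := by linear_combination -h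
      rw [this, norm_one] at hx
      exact lt_irrefl _ hx
    have hx1' : 1 + x ≠ 0 := by
      intro h
      have : x = -1 := by linear_combination h
      rw [this, norm_neg, norm_one] at hx
      exact lt_irrefl _ hx
    have hχx : 1 - κ p * x ≠ 0 := by
      intro h
      have h1 : κ p * x = 1 := by linear_combination -h
      have : ‖κ (p : ℕ) * x‖ < 1 := by
        rw [norm_mul]
        calc ‖κ (p : ℕ)‖ * ‖x‖ ≤ 1 * ‖x‖ := by gcongr; exact κ.norm_le_one _
          _ < 1 := by rw [one_mul]; exact hx
      rw [h1, norm_one] at this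
      exact lt_irrefl _ this
    rw [hx2]
    have h1x2 : 1 - x ^ 2 = (1 - x) * (1 + x) := by ring
    rw [h1x2]
    field_simp
  rw [hF] at hrhs
  exact hlhs.unique hrhs

end DirichletSeries

end BinQF

end Literature.NumberTheory.QuadraticFields.Quadratic
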